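import Mathlib
import Summits.Ventures.PercRepro.TriangleCapFourRowCap

/-!
# PercRepro — THE CAP ON THE CELL `(k, 4, 3)`: a `K₄⁻`-free graph with `4 (k − 4) − 3` edges on `k ≥ 11` vertices
with a vertex of degree `k − 4` is `4`-bipartite or at least `B2 = 2k − 18` below the closed form (p3, gen 46;
part 199b)

On the cell `(k, 4, 3)` the stability table §10bt(e) predicts the non-bipartite gap `B2 = 2 (k − 2a − 1)(a − r) =
2k − 18`, attained by `K_{5,k−5}` minus a `(k − 6)`-star, below the one-triangle family `T = 2k − 16`. The cap lemma
of part 198a (`four_cap`, `r = 2`) is repeated with one more missing pair. With `N = N(x)`, `|N| = K = k − 4`, `M` the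
matching inside `N`, `R` the three non-neighbours, `P = Σ_{u ∈ R} degIn N u`, `E = adjPairs R`:
* the degree sum is `2K + 2M + 2P + E = 2m = 8K − 6`; one end per matching edge gives `P + 3M ≤ 3K`; an edge `u v`
  inside `R` with the third vertex `w`: if `u v w` is a triangle, `u` and `v` have no common neighbour in `N` at all
  (`not_adj_both` with `w`), so `P_u + P_v ≤ K` and `P + M ≤ 2K`; otherwise `E ≤ 4`, `P_u + P_v ≤ K + 1` and
  `P + M ≤ 2K + 1` — both contradict `2 (P + M) = 6K − 6 − E` for `K ≥ 7` (`four_three_noedge`,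
  `four_three_cap_count`); so `E = 0` and `2M ≤ 3`;
* `M = 0`: `D ⊆ K(N(x)ᶜ, N(x))`, `4`-bipartite;
* `M = 1`: `P = 3K − 4`; every `u ∈ R` has `d(u) = P_u ≤ K − 1`, so the three values are `K − 1, K − 1, K − 2` and
  `Σ_R d² = 3K² − 8K + 6` EXACTLY (`four_three_R_arith` — the crude `(K − 1) P` of part 198a is `K − 2` too weak
  here); `Σ_N d² ≤ K + 12 + 5P` as in part 198a; altogether `Σ d² ≤ 4K² + 13K − 12 = m k − 3 (k − 4) − (2k − 18)`
  exactly (`four_three_cap_sq_arith`).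
Axioms: standard.
-/

namespace PercRepro

namespace TriangleCap

namespace C047

open Finset

variable {V : Type*} [Fintype V] [DecidableEq V]

/-- The count at the cap of the cell `(k, 4, 3)`: `2K + 2M + 2P + E = 2m`, `m + 3 = 4K`, `P + 3M ≤ 3K`, `E ≤ 6`,
`K ≥ 7`, and an edge inside `R` forces `E ≤ 4 ∧ P + M ≤ 2K + 1` or `P + M ≤ 2K` ⇒ `E = 0` and `M ≤ 1`. -/
theorem four_three_cap_count (K M P E m : ℕ) (hdeg : K + (K + 2 * M + P) + (P + E) = 2 * m) (hm : m + 3 = 4 * K)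
    (h2 : P + 3 * M ≤ 3 * K) (hE : E ≤ 6) (hK : 7 ≤ K)
    (hnoedge : 1 ≤ E → (E ≤ 4 ∧ P + M ≤ 2 * K + 1) ∨ P + M ≤ 2 * K) :
    E = 0 ∧ M ≤ 1 := by
  by_cases hE1 : 1 ≤ E
  · rcases hnoedge hE1 with ⟨h1, h2'⟩ | h3 <;> omega
  · omega

/-- **THE EXACT `R`-SUM:** three values `≤ K − 1` with sum `3K − 4` are `K − 1, K − 1, K − 2`:
`x² + y² + z² + 8K ≤ 3K² + 6` (`K ≥ 7`). -/
theorem four_three_R_arith (x y z K : ℕ) (hK : 7 ≤ K) (hx : x + 1 ≤ K) (hy : y + 1 ≤ K) (hz : z + 1 ≤ K)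
    (hsum : x + y + z + 4 = 3 * K) : x * x + y * y + z * z + 8 * K ≤ 3 * (K * K) + 6 := by
  obtain ⟨t, rfl⟩ : ∃ t, K = t + 7 := ⟨K - 7, by omega⟩
  obtain ⟨a, ha, rfl⟩ : ∃ a, a ≤ 1 ∧ x = t + 5 + a := ⟨x - (t + 5), by omega, by omega⟩
  obtain ⟨b, hb, rfl⟩ : ∃ b, b ≤ 1 ∧ y = t + 5 + b := ⟨y - (t + 5), by omega, by omega⟩
  obtain ⟨c, hc, rfl⟩ : ∃ c, c ≤ 1 ∧ z = t + 5 + c := ⟨z - (t + 5), by omega, by omega⟩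
  have habc : a + b + c = 2 := by omega
  interval_cases a <;> interval_cases b <;> interval_cases c <;> nlinarith

/-- **THE ARITHMETIC OF THE CASE `M = 1`:** `K ≥ 7`, `m + 3 = 4K`, `P + 4 = 3K`, `S_N ≤ K + 12 + 5P`,
`S_R + 8K ≤ 3K² + 6` ⇒ `K² + S_N + S_R + 3 (k − 4) + (2k − 18) ≤ m k` with `k = K + 4`. -/
theorem four_three_cap_sq_arith (K P SN SR m : ℕ) (hK : 7 ≤ K) (hm : m + 3 = 4 * K) (hP : P + 4 = 3 * K)
    (hSN : SN ≤ K + 12 + 5 * P) (hSR : SR + 8 * K ≤ 3 * (K * K) + 6) :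
    K * K + SN + SR + 3 * (K + 4 - 4) + (2 * (K + 4) - 18) ≤ m * (K + 4) := by
  obtain ⟨t, rfl⟩ : ∃ t, K = t + 7 := ⟨K - 7, by omega⟩
  have hP' : P = 3 * t + 17 := by omega
  have hm' : m = 4 * t + 25 := by omega
  subst hP' hm'
  have e1 : t + 7 + 4 - 4 = t + 7 := by omega
  have e2 : 2 * (t + 7 + 4) - 18 = 2 * t + 4 := by omega
  rw [e1, e2]
  nlinarith [hSN, hSR]

/-- **AN EDGE INSIDE `R` IS IMPOSSIBLE AT THE CAP:** with `R = {u, v, w}` the three non-neighbours of `x`, an edge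
`u v` inside `R` gives `E ≤ 4 ∧ P + M ≤ 2K + 1` (no triangle: `P_u + P_v ≤ K + 1`, `P_w + M ≤ K`) or `P + M ≤ 2K`
(the triangle `u v w`: `u` and `v` share no neighbour in `N`, by `not_adj_both` with `w`). -/
theorem four_three_noedge (D : SimpleGraph V) [DecidableRel D.Adj] (hK : K4mFree D) (x : V) (N R : Finset V)
    (hmemN : ∀ w, w ∈ N ↔ D.Adj x w) (hmemR : ∀ w, w ∈ R ↔ w ≠ x ∧ ¬ D.Adj x w) (hRcard : R.card = 3)
    (K M : ℕ) (hKdef : N.card = K) (hPle : ∀ u ∈ R, degIn D N u + M ≤ K) (hE : 1 ≤ adjPairs D R) :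
    (adjPairs D R ≤ 4 ∧ ∑ u ∈ R, degIn D N u + M ≤ 2 * K + 1) ∨ ∑ u ∈ R, degIn D N u + M ≤ 2 * K := by
  -- an edge `u v` inside `R`
  obtain ⟨u, hu, hu1⟩ : ∃ u ∈ R, 1 ≤ degIn D R u := by
    by_contra hcon
    push Not at hcon
    have h0 : ∑ u ∈ R, degIn D R u = 0 := sum_eq_zero (fun u hu => by have := hcon u hu; omega)
    rw [← adjPairs_eq_sum_degIn] at h0
    omega
  obtain ⟨v, hv, huv⟩ : ∃ v ∈ R, D.Adj u v := by
    unfold degIn at hu1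
    obtain ⟨v, hv⟩ := card_pos.mp hu1
    rw [mem_filter] at hv
    exact ⟨v, hv.1, hv.2⟩
  have hne : u ≠ v := D.ne_of_adj huv
  -- the third vertex `w`
  have hvR' : v ∈ R.erase u := mem_erase.mpr ⟨hne.symm, hv⟩
  have hcard2 : ((R.erase u).erase v).card = 1 := by
    rw [card_erase_of_mem hvR', card_erase_of_mem hu]
    omega
  obtain ⟨w, hw⟩ := card_eq_one.mp hcard2
  have hwmem : w ∈ (R.erase u).erase v := by rw [hw]; exact mem_singleton_self w
  have hwv : w ≠ v := (mem_erase.mp hwmem).1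
  have hwu : w ≠ u := (mem_erase.mp (mem_of_mem_erase hwmem)).1
  have hwR : w ∈ R := mem_of_mem_erase (mem_of_mem_erase hwmem)
  have hR3 : R = insert u (insert v {w}) := by
    rw [← hw, insert_erase hvR', insert_erase hu]
  have hsum3 : ∀ f : V → ℕ, ∑ t ∈ R, f t = f u + f v + f w := by
    intro f
    rw [hR3, sum_insert, sum_insert, sum_singleton, add_assoc]
    · rw [mem_singleton]; exact hwv.symm
    · rw [mem_insert, mem_singleton]; push Not; exact ⟨hne, hwu.symm⟩
  have hmemR3 : ∀ t, t ∈ R ↔ t = u ∨ t = v ∨ t = w := by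
    intro t
    rw [hR3, mem_insert, mem_insert, mem_singleton]
  have hPw := hPle w hwR
  by_cases htri : D.Adj u w ∧ D.Adj v w
  · -- the triangle `u v w`: no common neighbour of `u`, `v` in `N`
    right
    have hdisj : Disjoint (N.filter (fun s => D.Adj u s)) (N.filter (fun s => D.Adj v s)) := by
      rw [disjoint_left]
      intro s hs1 hs2
      rw [mem_filter] at hs1 hs2
      have hsw : w ≠ s := by
        intro h
        rw [h] at hwR
        exact ((hmemR s).mp hwR).2 ((hmemN s).mp hs1.1)
      exact not_adj_both D hK huv htri.1 htri.2 hsw hs1.2 hs2.2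
    have huvK : degIn D N u + degIn D N v ≤ K := by
      unfold degIn
      have h := card_union_add_card_inter (N.filter (fun s => D.Adj u s)) (N.filter (fun s => D.Adj v s))
      rw [disjoint_iff_inter_eq_empty.mp hdisj, card_empty, add_zero] at h
      have hsub : (N.filter (fun s => D.Adj u s)) ∪ (N.filter (fun s => D.Adj v s)) ⊆ N :=
        union_subset (filter_subset _ _) (filter_subset _ _)
      have := card_le_card hsub
      omega
    rw [hsum3]
    omega
  · -- no triangle: `E ≤ 4`
    left
    have hPuv : degIn D N u + degIn D N v ≤ K + 1 := by
      have := degIn_add_degIn_le_of_adj_pair D hK N huv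
      rw [hKdef] at this
      exact this
    refine ⟨?_, by rw [hsum3]; omega⟩
    rw [adjPairs_eq_sum_degIn, hsum3]
    have hle2 : ∀ t ∈ R, degIn D R t ≤ 2 := fun t ht => by
      have := degIn_le_card_sub_one D ht
      rw [hRcard] at this
      exact this
    -- a vertex `t ∈ R` whose only possible `R`-neighbour is `v` has `degIn R t ≤ 1`
    have hsub1 : ∀ t, (∀ s ∈ R, D.Adj t s → s = v) → degIn D R t ≤ 1 := by
      intro t ht
      unfold degIn
      have : R.filter (fun s => D.Adj t s) ⊆ {v} := by
        intro s hs
        rw [mem_filter] at hs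
        rw [mem_singleton]
        exact ht s hs.1 hs.2
      have := card_le_card this
      rw [card_singleton] at this
      exact this
    rcases not_and_or.mp htri with huw | hvw
    · -- `u ≁ w`: `u` and `w` see only `v` inside `R`
      have h1 : degIn D R u ≤ 1 := hsub1 u (fun s hs hus => by
        rcases (hmemR3 s).mp hs with rfl | rfl | rfl
        · exact absurd hus (D.irrefl)
        · rfl
        · exact absurd hus huw)
      have h3 : degIn D R w ≤ 1 := hsub1 w (fun s hs hws => by
        rcases (hmemR3 s).mp hs with rfl | rfl | rfl
        · exact absurd (D.adj_symm hws) huw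
        · rfl
        · exact absurd hws (D.irrefl))
      have h2 := hle2 v hv
      omega
    · -- `v ≁ w`: `v` and `w` see only `u` inside `R`
      have hsub1' : ∀ t, (∀ s ∈ R, D.Adj t s → s = u) → degIn D R t ≤ 1 := by
        intro t ht
        unfold degIn
        have : R.filter (fun s => D.Adj t s) ⊆ {u} := by
          intro s hs
          rw [mem_filter] at hs
          rw [mem_singleton]
          exact ht s hs.1 hs.2
        have := card_le_card this
        rw [card_singleton] at this
        exact this
      have h2 : degIn D R v ≤ 1 := hsub1' v (fun s hs hvs => by
        rcases (hmemR3 s).mp hs with rfl | rfl | rfl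
        · rfl
        · exact absurd hvs (D.irrefl)
        · exact absurd hvs hvw)
      have h3 : degIn D R w ≤ 1 := hsub1' w (fun s hs hws => by
        rcases (hmemR3 s).mp hs with rfl | rfl | rfl
        · rfl
        · exact absurd (D.adj_symm hws) hvw
        · exact absurd hws (D.irrefl))
      have h1 := hle2 u hu
      omega

/-- **THE CAP ON THE CELL `(k, 4, 3)`, `k ≥ 11`:** a `K₄⁻`-free graph with `4 (k − 4) − 3` edges and a vertex `x` of
degree `k − 4` is a spanning subgraph of some `K(A, Aᶜ)` with `|A| = 4`, or
`Σ_v d(v)² + 3 (k − 4) + (2k − 18) ≤ m k` (the family `B2`, exact). -/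
theorem four_three_cap (D : SimpleGraph V) [DecidableRel D.Adj] (hK : K4mFree D) (hk : 11 ≤ Fintype.card V)
    (hm : D.edgeFinset.card + 3 = 4 * (Fintype.card V - 4)) (x : V) (hx : deg D x + 4 = Fintype.card V) :
    (∃ A : Finset V, A.card = 4 ∧ BipSub D A) ∨
      ∑ v, deg D v * deg D v + 3 * (Fintype.card V - 4) + (2 * Fintype.card V - 18) ≤
        D.edgeFinset.card * Fintype.card V := by
  obtain ⟨N, hN⟩ : ∃ N : Finset V, N = univ.filter (fun w => D.Adj x w) := ⟨_, rfl⟩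
  have hmemN : ∀ w, w ∈ N ↔ D.Adj x w := fun w => by rw [hN, mem_filter]; simp only [mem_univ, true_and]
  have hxN : x ∉ N := fun h => D.irrefl ((hmemN x).mp h)
  have hdx : deg D x = N.card := by rw [hN]; rfl
  obtain ⟨K, hKdef⟩ : ∃ K, N.card = K := ⟨_, rfl⟩
  have hcardV : Fintype.card V = K + 4 := by omega
  obtain ⟨m, hmdef⟩ : ∃ m, D.edgeFinset.card = m := ⟨_, rfl⟩
  rw [hmdef, hcardV, Nat.add_sub_cancel] at hm
  -- the non-neighbours `R`, `|R| = 3`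
  obtain ⟨R, hR⟩ : ∃ R : Finset V, R = (insert x N)ᶜ := ⟨_, rfl⟩
  have hRcard : R.card = 3 := by
    rw [hR, card_compl, card_insert_of_notMem hxN]
    omega
  have hmemR : ∀ w, w ∈ R ↔ w ≠ x ∧ ¬ D.Adj x w := by
    intro w
    rw [hR, mem_compl, mem_insert, hmemN]
    tauto
  -- the matching inside `N`
  obtain ⟨M, hM⟩ : ∃ M, adjPairs D N = 2 * M := ⟨_, adjPairs_eq_two_mul D N⟩
  have hTf : ∑ y ∈ N, degIn D N y = 2 * M := by rw [← adjPairs_eq_sum_degIn, hM]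
  -- `P = Σ_{u ∈ R} degIn N u`, `E = adjPairs R`
  obtain ⟨P, hPdef⟩ : ∃ P, ∑ u ∈ R, degIn D N u = P := ⟨_, rfl⟩
  obtain ⟨E, hEdef⟩ : ∃ E, adjPairs D R = E := ⟨_, rfl⟩
  -- the degree sum over `{x} ∪ N ∪ R`
  have hsplit : ∀ F : V → ℕ, ∑ w, F w = F x + ∑ y ∈ N, F y + ∑ u ∈ R, F u := by
    intro F
    rw [← sum_add_sum_compl (insert x N), sum_insert hxN, ← hR]
  have hdegN : ∀ y ∈ N, deg D y = 1 + degIn D N y + degIn D R y := by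
    intro y hy
    have := deg_eq_of_mem_nbhd D x y ((hmemN y).mp hy)
    rw [← hN, ← hR] at this
    exact this
  have hsumN : ∑ y ∈ N, deg D y = K + 2 * M + P := by
    rw [sum_congr rfl hdegN, sum_add_distrib, sum_add_distrib, sum_const, smul_eq_mul, mul_one, hKdef, hTf,
      sum_degIn_comm D N R, hPdef]
  have hdegR : ∀ u ∈ R, deg D u = degIn D N u + degIn D R u := by
    intro u hu
    have := deg_eq_of_not_mem_nbhd D x u ((hmemR u).mp hu).2
    rw [← hN, ← hR] at this
    exact this
  have hsumR : ∑ u ∈ R, deg D u = P + E := by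
    rw [sum_congr rfl hdegR, sum_add_distrib, hPdef, ← adjPairs_eq_sum_degIn, hEdef]
  have hdegsum := sum_deg_eq D
  rw [hsplit, hsumN, hsumR, hdx, hKdef, hmdef] at hdegsum
  -- (2) every vertex of `R` has at most `K − M` neighbours in `N` (one end of each matching edge)
  have hPle : ∀ u ∈ R, degIn D N u + M ≤ K := by
    intro u hu
    have := two_mul_degIn_add_adjPairs_le D hK (x := x) ((hmemR u).mp hu).1
    rw [← hN, hM, hKdef] at this
    omega
  have h2 : P + 3 * M ≤ 3 * K := by
    have hs : ∑ u ∈ R, (degIn D N u + M) ≤ ∑ _u ∈ R, K := sum_le_sum hPle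
    rw [sum_add_distrib, sum_const, sum_const, smul_eq_mul, smul_eq_mul, hPdef, hRcard] at hs
    exact hs
  -- (3) `E ≤ 6`
  have hE6 : E ≤ 6 := by
    have := adjPairs_le_card_mul_pred D R
    rw [hEdef, hRcard] at this
    exact this
  -- (4) an edge inside `R` is impossible
  have hnoedge : 1 ≤ E → (E ≤ 4 ∧ P + M ≤ 2 * K + 1) ∨ P + M ≤ 2 * K := by
    intro hE
    have := four_three_noedge D hK x N R hmemN hmemR hRcard K M hKdef hPle (by rw [hEdef]; exact hE)
    rw [hEdef, hPdef] at this
    exact this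
  -- (5) `E = 0`, `M ≤ 1`
  obtain ⟨hE0, hM1⟩ := four_three_cap_count K M P E m hdegsum hm h2 hE6 (by omega) hnoedge
  -- no edge inside `R`
  have hnoR : ∀ u ∈ R, degIn D R u = 0 := by
    intro u hu
    have hle : degIn D R u ≤ ∑ z ∈ R, degIn D R z := single_le_sum (fun _ _ => Nat.zero_le _) hu
    rw [← adjPairs_eq_sum_degIn, hEdef, hE0] at hle
    exact Nat.le_zero.mp hle
  rcases Nat.eq_zero_or_pos M with hM0 | hMpos
  · -- `M = 0`: no edge inside `N`, none inside `R`: `D ⊆ K(Nᶜ, N)`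
    left
    have hnoN : ∀ y ∈ N, ∀ y', D.Adj y y' → y' ∉ N := by
      intro y hy y' hyy' hy'
      have h0 : degIn D N y = 0 := by
        have hle : degIn D N y ≤ ∑ z ∈ N, degIn D N z := single_le_sum (fun _ _ => Nat.zero_le _) hy
        rw [hTf, hM0, mul_zero] at hle
        exact Nat.le_zero.mp hle
      unfold degIn at h0
      rw [card_eq_zero, filter_eq_empty_iff] at h0
      exact h0 hy' hyy'
    have hnoR' : ∀ u ∈ R, ∀ u', D.Adj u u' → u' ∉ R := by
      intro u hu u' huu' hu'
      have h0 := hnoR u hu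
      unfold degIn at h0
      rw [card_eq_zero, filter_eq_empty_iff] at h0
      exact h0 hu' huu'
    refine ⟨Nᶜ, ?_, ?_⟩
    · rw [card_compl, hKdef]
      omega
    · intro p q hpq
      rw [mem_compl, mem_compl, not_not]
      constructor
      · intro hpN
        by_contra hqN
        by_cases hpx : p = x
        · subst hpx
          exact hqN ((hmemN q).mpr hpq)
        by_cases hqx : q = x
        · subst hqx
          exact hpN ((hmemN p).mpr (D.adj_symm hpq))
        have hpR : p ∈ R := (hmemR p).mpr ⟨hpx, fun h => hpN ((hmemN p).mpr h)⟩
        have hqR : q ∈ R := (hmemR q).mpr ⟨hqx, fun h => hqN ((hmemN q).mpr h)⟩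
        exact hnoR' p hpR q hpq hqR
      · intro hqN hpN
        exact hnoN p hpN q hpq hqN
  · -- `M = 1`: the one-triangle structure with `P = 3K − 4`
    right
    have hM1' : M = 1 := by omega
    subst hM1'
    have hP : P + 4 = 3 * K := by omega
    -- `Σ_R d² = 3K² − 8K + 6` exactly: the three values are `K − 1, K − 1, K − 2`
    have hSR : ∑ u ∈ R, deg D u * deg D u + 8 * K ≤ 3 * (K * K) + 6 := by
      obtain ⟨u, v, w, huv, huw, hvw, hR3⟩ := card_eq_three.mp hRcard
      have hsum3 : ∀ f : V → ℕ, ∑ t ∈ R, f t = f u + f v + f w := by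
        intro f
        rw [hR3, sum_insert, sum_insert, sum_singleton, add_assoc]
        · rw [mem_singleton]; exact hvw
        · rw [mem_insert, mem_singleton]; push Not; exact ⟨huv, huw⟩
      have hmemR3 : ∀ t, t ∈ R ↔ t = u ∨ t = v ∨ t = w := by
        intro t
        rw [hR3, mem_insert, mem_insert, mem_singleton]
      have hdu : deg D u = degIn D N u := by
        rw [hdegR u ((hmemR3 u).mpr (Or.inl rfl)), hnoR u ((hmemR3 u).mpr (Or.inl rfl)), add_zero]
      have hdv : deg D v = degIn D N v := by
        rw [hdegR v ((hmemR3 v).mpr (Or.inr (Or.inl rfl))), hnoR v ((hmemR3 v).mpr (Or.inr (Or.inl rfl))),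
          add_zero]
      have hdw : deg D w = degIn D N w := by
        rw [hdegR w ((hmemR3 w).mpr (Or.inr (Or.inr rfl))), hnoR w ((hmemR3 w).mpr (Or.inr (Or.inr rfl))),
          add_zero]
      have hsumP : degIn D N u + degIn D N v + degIn D N w + 4 = 3 * K := by
        rw [← hsum3, hPdef]; exact hP
      rw [hsum3, hdu, hdv, hdw]
      exact four_three_R_arith _ _ _ K (by omega) (hPle u ((hmemR3 u).mpr (Or.inl rfl)))
        (hPle v ((hmemR3 v).mpr (Or.inr (Or.inl rfl)))) (hPle w ((hmemR3 w).mpr (Or.inr (Or.inr rfl)))) hsumP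
    -- `Σ_N d² ≤ K + 12 + 5P`
    have hfg : ∑ y ∈ N, degIn D N y * degIn D R y ≤ 3 := by
      have := two_mul_sum_degIn_mul_degIn_le D hK x R (fun u hu => ((hmemR u).mp hu).1)
      rw [← hN, hM, hRcard] at this
      omega
    have hSN : ∑ y ∈ N, deg D y * deg D y ≤ K + 12 + 5 * P := by
      have h : ∀ y ∈ N, deg D y * deg D y ≤
          1 + 3 * degIn D N y + 5 * degIn D R y + 2 * (degIn D N y * degIn D R y) := by
        intro y hy
        rw [hdegN y hy]
        apply cap_sq_bound
        · have h1 := degIn_nbhd_le_one D hK (x := x) (u := y) ((hmemN y).mp hy)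
          rw [← hN] at h1
          exact h1
        · have := degIn_le_card D R y
          rw [hRcard] at this
          exact this
      calc ∑ y ∈ N, deg D y * deg D y
          ≤ ∑ y ∈ N, (1 + 3 * degIn D N y + 5 * degIn D R y + 2 * (degIn D N y * degIn D R y)) := sum_le_sum h
        _ = N.card + 3 * ∑ y ∈ N, degIn D N y + 5 * ∑ y ∈ N, degIn D R y +
            2 * ∑ y ∈ N, degIn D N y * degIn D R y := by
          rw [sum_add_distrib, sum_add_distrib, sum_add_distrib, sum_const, smul_eq_mul, mul_one, mul_sum,
            mul_sum, mul_sum]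
        _ ≤ K + 12 + 5 * P := by
          rw [hKdef, hTf, sum_degIn_comm D N R, hPdef]
          omega
    rw [hsplit (fun v => deg D v * deg D v), hdx, hKdef, hmdef, hcardV]
    exact four_three_cap_sq_arith K P _ _ m (by omega) hm hP hSN hSR

end C047

end TriangleCap

end PercRepro
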